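import Summits.BirchSwinnertonDyer.Rank1Residual.X12.SupersingularTwo
import HarnessLib

/-!
# Deuring's criterion AT `p = 2` for CM curves over `ℚ` as a THEOREM — good ordinary at `2` ⟺
# `2` splits in the CM field (`K = ℚ(√−7)`) — and the `p = 2` corner of Burungale–Castella–Skinner–
# Tian's Theorem A with NO Deuring binder (cell `b2b-bsdres`, unit `b2b-bsdres-lit-bst`, gen 7;
# part B of two, part A = `X12/SupersingularTwo.lean`)

HONEST FRAMING (cell `b2b-bsdres`, run/shared/lean/b2b/bsd-rank1-residual/, verbatim in every
file): the goal of the cell is to DELETE the COMBINATION-SHAPED residual classes of the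
Birch–Swinnerton-Dyer formula for ALL analytic-rank `≤ 1` elliptic curves over `ℚ` — "full BSD
formula for every rank `≤ 1` curve in class `C`" assembled STRICTLY from published theorems — so
that the rank-`≤ 1` remainder becomes exactly the CONSTRUCTION-SHAPED classes, which are TYPED
(missing-input `Prop`s), NOT attempted. This is not "finishing BSD". Literature = cited statements
only; announced results enter only as OPEN hypotheses. THIS FILE: theorems only (no definition, no
named fact, no axiom); NEW WORK of the cell, hence under `Summits/`; nothing is booked; no label and
no census number moves; X12 stays CONSTRUCTION-SHAPED.

## What this file does (on top of part A: at a good `2`, `GoodOrd W 2 ⟺ Odd (num j)`)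

* §3 (CM). The thirteen CM `j`-invariants over `ℚ` are integers, ODD exactly for
  `j ∈ {−3375 = (−15)³, 16581375 = 255³}` = the two `ℚ(√−7)` values
  (`odd_num_iff_cmFieldDiscrOfJ_eq_neg_seven`). Hence for a CM curve `E/ℚ` with good reduction at
  `2`: **`GoodOrd E 2 ⟺ d_K = −7 ⟺ CMSplit E 2`** (`goodOrd_two_iff_cmFieldDiscrOfJ_eq_neg_seven`,
  `goodOrd_two_iff_cmSplit_two`) — Deuring's criterion (Lang, *Elliptic Functions*, Ch. 13 §4
  Thm. 12: "`Ā` is supersingular iff `p` ramifies or remains prime in `k`") AT `p = 2`, BOTH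
  directions, as a kernel theorem over `ℚ` — and `2 ∣ a_2(E)` whenever `d_K ≠ −7`
  (`two_dvd_frobeniusTrace_two_of_cmFieldDiscrOfJ_ne`; at a good `2` these are the `2`-inert fields
  `d_K ∈ {−3, −11, −19, −43, −67, −163}`, e.g. `27a`, `121b`, `361a`; for `d_K ∈ {−4, −8}` a good
  `2` never occurs, tree `X12.not_good_of_hasCM_of_dvd_cmFieldDiscrOfJ`); conversely
  `goodOrd_two_of_cmFieldDiscrOfJ_eq_neg_seven` (split ⟹ ordinary, e.g. `49a1`, `a_2 = 1`) — the
  direction the named fact does not even state.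
* §4 (consumers, binder `hDeu` REMOVED). `cmFieldDiscrOfJ_eq_neg_seven_of_goodOrd_two` (= BCST's
  `cmFieldDiscrOfJ_eq_of_goodOrd_two` minus `hDeu`); **`analyticRank_eq_one_of_goodOrd_two'`: the CM
  rank-one `2`-converse — CM ∧ good ordinary at `2` ∧ `corank_{ℤ₂} Sel_{2^∞}(E/ℚ) = 1 ⟹
  ord_{s=1} L(E,s) = 1` — now rests on ONE named fact, BCST 2022 Theorem A (`hA`)** (the tree's
  `X12.analyticRank_eq_one_of_goodOrd_two` also bound `hDeu`);
  `rank_eq_one_and_finite_sha_of_goodOrd_two'` (+ Gross–Zagier–Kolyvagin `hGZK`). Together with the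
  GLUE seat's odd-`p` theorem, "good ordinary ⟺ split in `K`" is now a kernel theorem for CM curves
  over `ℚ` at EVERY good prime; the named fact `deuring_not_hasUnitRootAt_of_hasCM_of_not_cmSplit`
  stays in use only where the tree needs it over number fields (potentially good reduction).

References: S. Lang, *Elliptic Functions*, GTM 112 (1987), Ch. 13 §4 Thm. 12 [Lang1987];
A. Burungale, F. Castella, C. Skinner, Y. Tian, Ann. Math. Québec 46 (2022) 325–346, Thm. A (p. 326),
(spl) (p. 329), Rem. D (p. 327: "`ℚ(√−7)` is the only imaginary quadratic field of class number 1
with 2 split") [BurungaleCastellaSkinnerTian2022]; J. H. Silverman, *Advanced Topics*, GTM 151,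
App. A §3 (table of CM `j`-invariants) [SilvermanATAEC1994]; J. H. Silverman, *AEC* 2nd ed., V Ex. 5.7
[SilvermanAEC2009]; H. Darmon, CBMS 101 (2004), Thm. 3.22 [Darmon2004];
HOME/b2b-bsdres-lit-bst/BST-BCST.md §11; HOME/b2b-bsdres-lit-glue/GLUE.md §G5.4 A10.
-/

set_option autoImplicit false

noncomputable section

open scoped Classical

open WeierstrassCurve Literature.NumberTheory.EllipticCurves
  Literature.NumberTheory.EllipticCurves.Rank1Residual
  Literature.NumberTheory.EllipticCurves.BurungaleCastellaSkinnerTian2022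

namespace Summit.BirchSwinnertonDyer.Rank1Residual.X12

/-! ## §3 CM curves: good ordinary at `2` ⟺ `d_K = −7` ⟺ `2` splits in `K` -/

section CM

/-- `q = z` for an integer `z` gives `num q = z`. [folklore] -/
private theorem num_eq_of_eq_intCast {q : ℚ} {z : ℤ} (h : q = (z : ℚ)) : q.num = z := by
  rw [h, Rat.num_intCast]

/-- **Among the thirteen CM `j`-invariants over `ℚ`, `num j` is odd exactly for the two
`ℚ(√−7)`-values `j = −3375 = (−15)³`, `16581375 = 255³`**; the other eleven
(`0, 54000, −12288000, 1728, 287496, 8000, −32768, −884736, −884736000, −147197952000,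
−262537412640768000`) are even integers. [cite: SilvermanATAEC1994, App. A §3 (table of CM j-invariants)] -/
theorem odd_num_iff_cmFieldDiscrOfJ_eq_neg_seven {j : ℚ} (h : cmFieldDiscrOfJ j ≠ 0) :
    Odd j.num ↔ cmFieldDiscrOfJ j = -7 := by
  unfold cmFieldDiscrOfJ at h ⊢
  split_ifs at h ⊢ with h3 h4 h7 h8 h11 h19 h43 h67 h163
  · rcases h3 with hj | hj | hj
    · rw [num_eq_of_eq_intCast (z := 0) (by rw [hj]; norm_num)]; decide
    · rw [num_eq_of_eq_intCast (z := 54000) (by rw [hj]; norm_num)]; decide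
    · rw [num_eq_of_eq_intCast (z := -12288000) (by rw [hj]; norm_num)]; decide
  · rcases h4 with hj | hj
    · rw [num_eq_of_eq_intCast (z := 1728) (by rw [hj]; norm_num)]; decide
    · rw [num_eq_of_eq_intCast (z := 287496) (by rw [hj]; norm_num)]; decide
  · rcases h7 with hj | hj
    · rw [num_eq_of_eq_intCast (z := -3375) (by rw [hj]; norm_num)]; decide
    · rw [num_eq_of_eq_intCast (z := 16581375) (by rw [hj]; norm_num)]; decide
  · rw [num_eq_of_eq_intCast (z := 8000) (by rw [h8]; norm_num)]; decide
  · rw [num_eq_of_eq_intCast (z := -32768) (by rw [h11]; norm_num)]; decide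
  · rw [num_eq_of_eq_intCast (z := -884736) (by rw [h19]; norm_num)]; decide
  · rw [num_eq_of_eq_intCast (z := -884736000) (by rw [h43]; norm_num)]; decide
  · rw [num_eq_of_eq_intCast (z := -147197952000) (by rw [h67]; norm_num)]; decide
  · rw [num_eq_of_eq_intCast (z := -262537412640768000) (by rw [h163]; norm_num)]; decide
  · exact absurd rfl h

variable (W : WeierstrassCurve ℚ) [W.IsElliptic] [W.IsGloballyMinimal]

/-- **Deuring at `2`, over `ℚ`, as a theorem: a CM curve with good reduction at `2` is ORDINARY at
`2` iff its CM field is `ℚ(√−7)`** (`d_K = −7`, `j ∈ {−3375, 16581375}`). No Deuring binder: §2 +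
the parity of the thirteen CM `j`'s (`HasCM ⟹ d_K ≠ 0`, tree `X12.cmFieldDiscrOfJ_ne_zero_of_hasCM`).
[cite: Lang1987, Ch. 13 §4 Thm. 12] [cite: BurungaleCastellaSkinnerTian2022, Rem. D (p. 327)]
[cite: SilvermanAEC2009, V Ex. 5.7] -/
theorem goodOrd_two_iff_cmFieldDiscrOfJ_eq_neg_seven (hCM : W.HasCM) (hgood : Good W 2) :
    GoodOrd W 2 ↔ cmFieldDiscrOfJ W.j = -7 := by
  rw [goodOrd_two_iff_odd_num_j,
    odd_num_iff_cmFieldDiscrOfJ_eq_neg_seven (cmFieldDiscrOfJ_ne_zero_of_hasCM W hCM)]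
  exact ⟨fun h ↦ h.2, fun h ↦ ⟨hgood, h⟩⟩

/-- **Deuring's criterion at `p = 2` for CM curves over `ℚ`, both directions, as a theorem:
good ordinary at `2` ⟺ `2` splits in the CM field** (`CMSplit W 2 ⟺ d_K ≡ 1 (mod 8) ⟺ d_K = −7`,
BCST `cmFieldDiscrOfJ_eq_of_cmSplit_two` / `cmSplit_two_of_cmFieldDiscrOfJ_eq`). The odd-prime
companion is the GLUE seat's `goodOrd_iff_cmSplit_of_hasCM_of_good` (`p ≠ 2`).
[cite: Lang1987, Ch. 13 §4 Thm. 12] [cite: BurungaleCastellaSkinnerTian2022, (spl) (p. 329) and Rem. D (p. 327)] -/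
theorem goodOrd_two_iff_cmSplit_two (hCM : W.HasCM) (hgood : Good W 2) :
    GoodOrd W 2 ↔ CMSplit W 2 := by
  rw [goodOrd_two_iff_cmFieldDiscrOfJ_eq_neg_seven W hCM hgood]
  exact ⟨cmSplit_two_of_cmFieldDiscrOfJ_eq W, cmFieldDiscrOfJ_eq_of_cmSplit_two W⟩

/-- **Supersingular half at `2`: good at `2` ∧ `2` not split in `K` ⟹ good supersingular at `2`.**
[cite: Lang1987, Ch. 13 §4 Thm. 12] -/
theorem goodSS_two_iff_not_cmSplit_two (hCM : W.HasCM) (hgood : Good W 2) :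
    GoodSS W 2 ↔ ¬ CMSplit W 2 := by
  rw [← goodOrd_two_iff_cmSplit_two W hCM hgood]
  unfold GoodSS GoodOrd Good at *
  tauto

/-- **`2 ∣ a_2(E)` for every CM curve `E/ℚ` with good reduction at `2` whose CM field is not
`ℚ(√−7)`** (i.e. `d_K ∈ {−3, −11, −19, −43, −67, −163}`, `2` inert: e.g. `27a`, `121b`, `361a`; for
`d_K ∈ {−4, −8}` a good `2` does not occur). [cite: Lang1987, Ch. 13 §4 Thm. 12] [cite: SilvermanAEC2009, V Ex. 5.7] -/
theorem two_dvd_frobeniusTrace_two_of_cmFieldDiscrOfJ_ne (hCM : W.HasCM)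
    (hgood : W.HasGoodReductionAtPrime 2) (hK : cmFieldDiscrOfJ W.j ≠ -7) :
    (2 : ℤ) ∣ W.frobeniusTrace 2 := by
  by_contra hord
  have hgo : GoodOrd W 2 := ⟨hgood, by exact_mod_cast hord⟩
  exact hK ((goodOrd_two_iff_cmFieldDiscrOfJ_eq_neg_seven W hCM hgood).mp hgo)

/-- **Split ⟹ ordinary at `2`: a curve with `d_K = −7` (`j ∈ {−3375, 16581375}`) and good
reduction at `2` is good ORDINARY at `2`** (`a_2` odd; e.g. `49a1`, `a_2 = 1`). The direction the
named fact `deuring_not_hasUnitRootAt_of_hasCM_of_not_cmSplit` does not state. No CM hypothesis is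
needed: `j` alone decides. [cite: Lang1987, Ch. 13 §4 Thm. 12] [cite: SilvermanAEC2009, V Ex. 5.7] -/
theorem goodOrd_two_of_cmFieldDiscrOfJ_eq_neg_seven (hgood : Good W 2)
    (hK : cmFieldDiscrOfJ W.j = -7) : GoodOrd W 2 := by
  rw [goodOrd_two_iff_odd_num_j]
  refine ⟨hgood, (odd_num_iff_cmFieldDiscrOfJ_eq_neg_seven ?_).mpr hK⟩
  rw [hK]; decide

/-! ## §4 Consumers: the `p = 2` corner of BCST Theorem A with the Deuring binder REMOVED -/

/-- **BCST's `p = 2` corner lemma without `hDeu`**: CM ∧ good ordinary at `2` ⟹ `d_K = −7`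
(`BurungaleCastellaSkinnerTian2022.cmFieldDiscrOfJ_eq_of_goodOrd_two` minus its Deuring binder).
[cite: BurungaleCastellaSkinnerTian2022, Thm. A (p. 326) and Rem. D (p. 327)] -/
theorem cmFieldDiscrOfJ_eq_neg_seven_of_goodOrd_two (hCM : W.HasCM)
    (hgood : W.HasGoodReductionAtPrime 2) (hord : ¬ ((2 : ℕ) : ℤ) ∣ W.frobeniusTrace 2) :
    cmFieldDiscrOfJ W.j = -7 :=
  (goodOrd_two_iff_cmFieldDiscrOfJ_eq_neg_seven W hCM hgood).mp ⟨hgood, hord⟩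

/-- **The CM rank-one `2`-converse on ONE named fact.** For a CM elliptic curve `E/ℚ` with good
ordinary reduction at `2`: `corank_{ℤ₂} Sel_{2^∞}(E/ℚ) = 1 ⟹ ord_{s=1} L(E, s) = 1`, from BCST 2022
Theorem A ALONE (binder `hA`): good ordinary at `2` forces `K = ℚ(√−7)` (§3, kernel), where the
conductor hypothesis `𝔡_K ∥ 𝔣_λ` is automatic (`X12.differentExactlyDividesHeckeConductor_of_cmFieldDiscrOfJ_eq_neg_seven`).
Supersedes `X12.analyticRank_eq_one_of_goodOrd_two` (which also bound `hDeu`). RANK-PART only.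
[cite: BurungaleCastellaSkinnerTian2022, Thm. A (p. 326) and Rem. D (p. 327)] -/
theorem analyticRank_eq_one_of_goodOrd_two' (hA : thmA_analyticRank_eq_one_of_selmerCorank_eq_one)
    (hCM : W.HasCM) (hgood : W.HasGoodReductionAtPrime 2)
    (hord : ¬ ((2 : ℕ) : ℤ) ∣ W.frobeniusTrace 2) (hcorank : W.selmerCorank 2 = 1) :
    W.analyticRank = 1 :=
  hA W hCM (differentExactlyDividesHeckeConductor_of_cmFieldDiscrOfJ_eq_neg_seven W hCM
    (cmFieldDiscrOfJ_eq_neg_seven_of_goodOrd_two W hCM hgood hord)) 2 hgood hord hcorank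

/-- **… and then `rank E(ℚ) = 1` and `#Ш(E/ℚ) < ∞`** (Theorem A's "In particular" at `p = 2`;
binders: BCST Thm A `hA` and Gross–Zagier–Kolyvagin–Rubin `hGZK` only).
[cite: BurungaleCastellaSkinnerTian2022, Thm. A (p. 326)] [cite: Darmon2004, Thm. 3.22] -/
theorem rank_eq_one_and_finite_sha_of_goodOrd_two'
    (hA : thmA_analyticRank_eq_one_of_selmerCorank_eq_one)
    (hGZK : rank_eq_analyticRank_of_analyticRank_le_one) (hCM : W.HasCM)
    (hgood : W.HasGoodReductionAtPrime 2) (hord : ¬ ((2 : ℕ) : ℤ) ∣ W.frobeniusTrace 2)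
    (hcorank : W.selmerCorank 2 = 1) :
    W.analyticRank = 1 ∧ W.mordellWeilRank = 1 ∧ Finite W.sha :=
  thmA_inParticular hA hGZK W hCM
    (differentExactlyDividesHeckeConductor_of_cmFieldDiscrOfJ_eq_neg_seven W hCM
      (cmFieldDiscrOfJ_eq_neg_seven_of_goodOrd_two W hCM hgood hord)) 2 hgood hord hcorank


/-! ## §5 (gen 7 append) The sharp form at a supersingular `2`: `2¹² ∣ num j`; hence a CM curve with
good reduction at `2` has `2` UNRAMIFIED in `K` (and `j ≠ 54000`), and the trichotomy at `2` -/

/-- `2 ∣ a₁ ⟹ 16 ∣ c₄` for an integral Weierstrass equation: with `a₁ = 2k`,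
`b₂ = 4(k² + a₂)`, `b₄ = 2(a₄ + k a₃)`, so `c₄ = b₂² − 24 b₄ = 16((k² + a₂)² − 3(a₄ + k a₃))`
(Silverman *AEC* III.1). [cite: SilvermanAEC2009, III.1 (b₂, b₄, c₄)] -/
theorem sixteen_dvd_c₄_of_two_dvd_a₁ (M : WeierstrassCurve ℤ) (h : (2 : ℤ) ∣ M.a₁) :
    (16 : ℤ) ∣ M.c₄ := by
  obtain ⟨k, hk⟩ := h
  refine ⟨(k ^ 2 + M.a₂) ^ 2 - 3 * (M.a₄ + k * M.a₃), ?_⟩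
  simp only [WeierstrassCurve.c₄, WeierstrassCurve.b₂, WeierstrassCurve.b₄, hk]
  ring

/-- An odd integer is coprime to `2`. [folklore] -/
private theorem isCoprime_two_of_odd {n : ℤ} (h : Odd n) : IsCoprime (2 : ℤ) n := by
  obtain ⟨m, hm⟩ := h
  exact ⟨-m, 1, by rw [hm]; ring⟩

/-- **At a good `2`: `num j` is odd (ordinary) or divisible by `2¹²` (supersingular)** — for every
elliptic curve over `ℚ` with good reduction at `2`. Supersingular means `2 ∣ a₁` (part A), hence
`16 ∣ c₄`, and `num(j)·Δ_min = c₄³·den(j)` with `Δ_min` odd gives `2¹² ∣ num j`. Examples: `11a1`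
(`num j = −2¹²·29791`), `37a1` (`2¹²·27`), `27a1` (`j = −2¹⁵·375`). [cite: SilvermanAEC2009, III.1 and V Ex. 5.7] -/
theorem odd_num_j_or_two_pow_twelve_dvd_of_good_two (hgood : W.HasGoodReductionAtPrime 2) :
    Odd W.j.num ∨ (2 : ℤ) ^ 12 ∣ W.j.num := by
  by_cases ha : (2 : ℤ) ∣ (integralModelInt W).a₁
  · right
    have hΔ : ¬ (2 : ℤ) ∣ minimalDiscriminantInt W :=
      by exact_mod_cast not_dvd_minimalDiscriminantInt_of_hasGoodReductionAtPrime' W 2 hgood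
    have hΔodd : Odd (minimalDiscriminantInt W) :=
      Int.not_even_iff_odd.mp (even_iff_two_dvd.not.mpr hΔ)
    have h16 := sixteen_dvd_c₄_of_two_dvd_a₁ (integralModelInt W) ha
    have h12 : (2 : ℤ) ^ 12 ∣ (integralModelInt W).c₄ ^ 3 * (W.j.den : ℤ) := by
      have : (2 : ℤ) ^ 12 = 16 ^ 3 := by norm_num
      rw [this]
      exact (pow_dvd_pow_of_dvd h16 3).mul_right _
    rw [← num_j_mul_minimalDiscriminantInt W] at h12
    exact ((isCoprime_two_of_odd hΔodd).pow_left).dvd_of_dvd_mul_right h12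
  · left
    have hord : ¬ (2 : ℤ) ∣ W.frobeniusTrace 2 :=
      fun h ↦ ha ((two_dvd_frobeniusTrace_two_iff_two_dvd_a₁ W hgood).mp h)
    exact ((goodOrd_two_iff_odd_num_j W).mp ⟨hgood, by exact_mod_cast hord⟩).2

/-- Among the thirteen CM `j`-invariants, `num j` is odd or divisible by `2¹²` exactly off
`j ∈ {1728, 287496, 8000, 54000}` (`1728 = 2⁶·27`, `287496 = 2³·3³·11³`, `8000 = 2⁶·5³`,
`54000 = 2⁴·3³·5³`; the others: `0`, `−2¹⁵·375`, odd, odd, `−2¹⁵`, `−2¹⁵·27`, `−2¹⁸·3³·5³`,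
`−2¹⁵·165³`, `−2¹⁸·10005³`). [cite: SilvermanATAEC1994, App. A §3 (table of CM j-invariants)] -/
theorem j_ne_of_odd_num_or_two_pow_twelve_dvd {j : ℚ} (h0 : cmFieldDiscrOfJ j ≠ 0)
    (h : Odd j.num ∨ (2 : ℤ) ^ 12 ∣ j.num) :
    j ≠ 1728 ∧ j ≠ 287496 ∧ j ≠ 8000 ∧ j ≠ 54000 := by
  refine ⟨?_, ?_, ?_, ?_⟩ <;> rintro rfl
  · rw [num_eq_of_eq_intCast (z := 1728) (by norm_num)] at h; revert h; decide
  · rw [num_eq_of_eq_intCast (z := 287496) (by norm_num)] at h; revert h; decide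
  · rw [num_eq_of_eq_intCast (z := 8000) (by norm_num)] at h; revert h; decide
  · rw [num_eq_of_eq_intCast (z := 54000) (by norm_num)] at h; revert h; decide

/-- **A CM curve over `ℚ` with good reduction at `2` has `j ∉ {1728, 287496, 8000, 54000}`** —
i.e. the `ℚ(i)`- and `ℚ(√−2)`-curves (the fields in which `2` RAMIFIES) and the `j = 54000` curves
(CM by `ℤ[√−3]`, conductor-`2` order) are never good at `2`; kernel form of "a prime ramified in
the CM field is a bad prime" AT `p = 2` (the tree's `X12.not_good_of_hasCM_of_dvd_cmFieldDiscrOfJ`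
is stated for odd `p`). [cite: SilvermanAEC2009, Cor. VII.7.2 and V Ex. 5.7] [cite: SilvermanATAEC1994, App. A §3] -/
theorem j_ne_of_hasCM_of_good_two (hCM : W.HasCM) (hgood : W.HasGoodReductionAtPrime 2) :
    W.j ≠ 1728 ∧ W.j ≠ 287496 ∧ W.j ≠ 8000 ∧ W.j ≠ 54000 :=
  j_ne_of_odd_num_or_two_pow_twelve_dvd (cmFieldDiscrOfJ_ne_zero_of_hasCM W hCM)
    (odd_num_j_or_two_pow_twelve_dvd_of_good_two W hgood)

/-- **`2` ramified in the CM field ⟹ bad reduction at `2`**: `CMRamified W 2` (`2 ∣ d_K`, i.e.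
`d_K ∈ {−4, −8}`, `j ∈ {1728, 287496, 8000}`) ⟹ `¬ Good W 2` — the `p = 2` case missing from
`X12.not_good_of_cmRamified` (`p ≠ 2`). [cite: SilvermanAEC2009, Cor. VII.7.2] [cite: SilvermanATAEC1994, App. A §3] -/
theorem not_good_two_of_cmRamified_two (hCM : W.HasCM) (h : CMRamified W 2) : ¬ Good W 2 := by
  intro hgood
  obtain ⟨h1, h2, h3, -⟩ := j_ne_of_hasCM_of_good_two W hCM hgood
  have h0 := cmFieldDiscrOfJ_ne_zero_of_hasCM W hCM
  unfold CMRamified cmFieldDiscrOfJ at h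
  unfold cmFieldDiscrOfJ at h0
  split_ifs at h h0 with h3' h4 h7 h8 <;> first
    | exact absurd h (by decide)
    | (rcases h4 with hj | hj <;> simp_all)
    | exact h3 h8
    | exact h0 rfl

/-- **A CM curve with good reduction at `2` has `2` UNRAMIFIED in `K`** (the `p = 2` case of
`X12.not_cmRamified_of_hasCM_of_good`). [cite: SilvermanAEC2009, Cor. VII.7.2] -/
theorem not_cmRamified_two_of_hasCM_of_good_two (hCM : W.HasCM) (hgood : Good W 2) :
    ¬ CMRamified W 2 :=
  fun h ↦ not_good_two_of_cmRamified_two W hCM h hgood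

/-- **Trichotomy at a good `2`: split or inert** (the `p = 2` case of the GLUE seat's
`cmSplit_or_cmInert_of_hasCM_of_good`). [cite: Lang1987, Ch. 13 §4 Thm. 12] -/
theorem cmSplit_or_cmInert_of_hasCM_of_good_two (hCM : W.HasCM) (hgood : Good W 2) :
    CMSplit W 2 ∨ CMInert W 2 := by
  by_cases hs : CMSplit W 2
  · exact Or.inl hs
  · exact Or.inr ⟨not_cmRamified_two_of_hasCM_of_good_two W hCM hgood, hs⟩

/-- **Deuring's criterion at `2`, supersingular half, in the GLUE seat's shape: `GoodSS W 2 ↔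
CMInert W 2`** on {CM, good at `2`} (the `p = 2` twin of `goodSS_iff_cmInert_of_hasCM_of_good`).
[cite: Lang1987, Ch. 13 §4 Thm. 12] -/
theorem goodSS_two_iff_cmInert_two (hCM : W.HasCM) (hgood : Good W 2) :
    GoodSS W 2 ↔ CMInert W 2 := by
  rw [goodSS_two_iff_not_cmSplit_two W hCM hgood]
  exact ⟨fun h ↦ ⟨not_cmRamified_two_of_hasCM_of_good_two W hCM hgood, h⟩, fun h ↦ h.2⟩

end CM

end Summit.BirchSwinnertonDyer.Rank1Residual.X12

end
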